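import Summits.AtomisticToContinuum.Crystallization.Theorems.PhononSlackCertificatesAllBadGapFloor

/-!
# Sub-configuration floor `|S| · e* ≤ 𝓔_LJ(x|_S)` (stub `stub_subconfigurationFloor` of `GapTwelveToBarlow`)

Bookkeeping input of the energetic half (card `estar-absorbing-priced-pieces`) of the line `Sketch`
for the crux `SquareWellLayerCake.GapTwelveToBarlow` (item stmt-AtomisticToContinuum-15807): a
minimiser is cut into pieces and EVERY piece `S` is floored at `|S| · e*`, where
`e* = ⨅_Q e(Q)` is the infimum of the Lennard-Jones energy per particle over periodic
configurations of `ℝ³`.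

`stub_subconfigurationFloor`: for every injective configuration `x : Fin N → ℝ³` and every
`S : Finset (Fin N)`,
`|S| · e* ≤ ∑_{i ∈ S} ∑_{j ∈ S, i < j} V_LJ(|xᵢ − xⱼ|)`.

Proof: reindex `S` increasingly by `e := S.orderEmbOfFin rfl : Fin |S| ↪o Fin N`; the
sub-configuration `x ∘ e` is injective, so the tree's unconditional floor
`PhononSlackCertificatesAllBadGapFloor.card_mul_iInf_le_interactionEnergy` gives
`|S| · e* ≤ 𝓔_LJ(x ∘ e)`, and `𝓔_LJ(x ∘ e) = ∑_a ∑_{b > a} V_LJ(|x_{e a} − x_{e b}|)` is the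
double sum over `S` restricted to `i < j` because `e` is strictly monotone with image `S`
(`Finset.map_orderEmbOfFin_univ`, `Finset.sum_map`).  Nothing else is here.
-/

noncomputable section

namespace Summit.AtomisticToContinuum.Crystallization.Theorems.SquareWellLayerCakeGapTwelveToBarlow

open Literature.MathematicalPhysics.StatisticalMechanics
open Summit.AtomisticToContinuum.Crystallization.Theorems.PhononSlackCertificatesAllBadGapFloor
  (card_mul_iInf_le_interactionEnergy)

/-- Reindexing the interaction energy of a sub-configuration: for an order embedding
`e : Fin k ↪o Fin N`, `𝓔_V(x ∘ e) = ∑_{i ∈ e(univ)} ∑_{j ∈ e(univ)} [i < j] V(|xᵢ − xⱼ|)`. -/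
theorem interactionEnergy_comp_orderEmb (V : ℝ → ℝ) {N k : ℕ}
    (x : Fin N → EuclideanSpace ℝ (Fin 3)) (e : Fin k ↪o Fin N) :
    interactionEnergy V (x ∘ e) =
      ∑ i ∈ Finset.univ.map e.toEmbedding, ∑ j ∈ Finset.univ.map e.toEmbedding,
        if i < j then V (dist (x i) (x j)) else 0 := by
  simp only [interactionEnergy, Finset.sum_map, RelEmbedding.coe_toEmbedding,
    Function.comp_apply, e.lt_iff_lt]
  refine Finset.sum_congr rfl fun a _ => ?_
  rw [← Finset.sum_filter]
  refine Finset.sum_congr ?_ fun b _ => rfl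
  ext b
  simp

/-- **Sub-configuration floor** (`stub_subconfigurationFloor`): every sub-configuration `S` of an
injective configuration `x : Fin N → ℝ³` is worth at least `|S| · e*`,
`e* = ⨅_Q e(Q)` over periodic configurations:
`|S| · e* ≤ ∑_{i ∈ S} ∑_{j ∈ S, i < j} V_LJ(|xᵢ − xⱼ|)` — the tree's unconditional floor
`card_mul_iInf_le_interactionEnergy` applied to the increasing reindexing `x ∘ S.orderEmbOfFin rfl`.
For `S = ∅` both sides vanish. -/
theorem stub_subconfigurationFloor :
    ∀ (N : ℕ) (x : Fin N → EuclideanSpace ℝ (Fin 3)), Function.Injective x → ∀ S : Finset (Fin N),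
      (S.card : ℝ) * (⨅ Q : PeriodicConfiguration 3, Q.energyPerParticle lennardJones) ≤
        ∑ i ∈ S, ∑ j ∈ S, if i < j then lennardJones (dist (x i) (x j)) else 0 := by
  intro N x hx S
  set e : Fin S.card ↪o Fin N := S.orderEmbOfFin rfl with he
  have hy : Function.Injective (x ∘ e) := hx.comp e.injective
  have hS : Finset.univ.map e.toEmbedding = S := Finset.map_orderEmbOfFin_univ S rfl
  calc (S.card : ℝ) * (⨅ Q : PeriodicConfiguration 3, Q.energyPerParticle lennardJones)
      ≤ interactionEnergy lennardJones (x ∘ e) := card_mul_iInf_le_interactionEnergy hy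
    _ = ∑ i ∈ Finset.univ.map e.toEmbedding, ∑ j ∈ Finset.univ.map e.toEmbedding,
          if i < j then lennardJones (dist (x i) (x j)) else 0 :=
        interactionEnergy_comp_orderEmb lennardJones x e
    _ = ∑ i ∈ S, ∑ j ∈ S, if i < j then lennardJones (dist (x i) (x j)) else 0 := by rw [hS]

end Summit.AtomisticToContinuum.Crystallization.Theorems.SquareWellLayerCakeGapTwelveToBarlow

end
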